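import Literature.MathematicalPhysics.QuantumFieldTheory.Balaban1983to89.Step
import Literature.MathematicalPhysics.QuantumFieldTheory.Balaban1983to89.T4CauchySum

/-!
# TermwiseCouplingMismatch — leaf S.4 (γ) of the ROUND-2 skeleton of road P1 (term-wise) for row NE7, SPLIT IN KERNEL:
# the two runs' coupling-mismatch remainders `γ = Σ_x (g^{−2}(x) − w₀)·ρ_x(U)` differ by
# (intra-block variation + block discrepancy of the couplings) × (one-run action) + (coupling deviation) × (two-run
# fine-action closeness per block + one-run per-block classical deviation) — an identity of finite sums plus four
# displayed inputs; the END's binder `hγ` PRODUCED from them, its summability from polynomial × geometric majorants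

Cell `pub-balaban`, rung (B)+1 sub-cell t4, lineage `b2b-balaban-t4-ne7-p1` (node U5 = NE7, TERM-WISE member;
generation 18), skeleton `HOME/t4/b2b-balaban-t4-ne7-p1-g18/SKELETON-NE7-P1.md` §2 leaf S.4, record
`t4/T4-EST-NE7-P1.md` §24.  HONEST FRAMING (page 1): FIXED FINITE T⁴, rung (B)+1 = the `ε → 0` limit of unit-scale
averaged expectations, CONDITIONAL on BetaPertH and the nine spine estimates (0/9 proved); NOT infinite volume, NOT a
mass gap, NOT the Clay problem.  NE7 is NOT PRINTED in [Balaban1984PropagatorsI]–[Balaban1989LargeFieldII] and NOT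
proved here.  Every estimate below is a HYPOTHESIS BINDER named in the statement; the theorems are [folklore]
finite-sum algebra, one reading of the tree's typed flow window `Step.Discrete031` ((0.31) of [Balaban1987RG1], the
cell's BetaPertH road — a hypothesis, by name), and comparison of real series.  No definitions, no cite tags.

WHY (record §24 (24g)).  Generation 8 (`T4TermwiseAction`) split the action exponent of a good term as
`a = w₀·S(minimiser) + γ`, `γ = Σ_x (w(x) − w₀)·ρ_x` (the position-dependent coupling `w = g_k^{−2}(·)` of
[Balaban1988Convergent] (2.24) p. 259 minus the common constant `w₀`, supported in `Z_k` by p. 277), and left the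
two-run difference as the binder (γ) `|γ^B − γ^A| ≤ vol·rγ_K`, `Σ rγ < ∞` — one of the three OWN-OPEN leaves of the
skeleton.  Its lemma `couplingMismatch_abs_le` compares the two runs site by site on ONE index set.  But run A's
remainder lives on its own (coarse) plaquettes and run B's on the fine ones; the honest comparison groups the fine
plaquettes by blocks.  This file does that grouping and names the FOUR inputs the difference then consists of:
(γ1) the INTRA-BLOCK VARIATION of run B's coupling `|w_B(x) − w̄_B(blk x)| ≤ ι` (one run; (2.24): `φ_j` varies on
     scale `L^jη`, so under the I-3 window (levels `≥ jlogOf Cl K`) `ι` is `β′·L^{1−jlog}`-small — LOCATED, a binder);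
(γ2) the BLOCK COUPLING DISCREPANCY `|w̄_B(y) − w_A(y)| ≤ d` (node U2 / row NE4's `disc` at the levels present — ROW);
     both multiply run B's ONE-RUN action on the support, `Σ_x ρ_B(x) ≤ Aact` (regular backgrounds: bounded, polynomial
     in `K` under I-3 — PRINTED-1RUN shape);
(γ3) the TWO-RUN FINE-ACTION CLOSENESS PER BLOCK `Σ_y |Σ_{x∈y} ρ_B(x) − Σ_{x∈y} ρ_L(x)| ≤ e` between run B's minimiser
     and the LIFT of run A's minimiser to the fine fibre (row NE3's η-rate of the nested minimisers READ AT THE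
     PLAQUETTE LEVEL — a NAMED ASK of row NE3, NOT PRINTED);
(γ4) the ONE-RUN PER-BLOCK CLASSICAL DEVIATION `Σ_y |Σ_{x∈y} ρ_L(x) − ρ_A(y)| ≤ δ` (fine action of the lift vs coarse
     action, block by block — the local form of the (U)(L) analysis of generations 9–17; bookkeeping over landed
     local lemmas, not done here);
     both multiply the COUPLING DEVIATION `|w_A(y) − w₀| ≤ W`, which §2 reads off the flow window: a coupling frozen at
     level `k` deviates from the final one by `≤ β′(K − k)` (`Step.Discrete031`, upper half).
So (γ) ⇐ (γ1)(γ2)(γ3)(γ4) + (0.31): after this file the OWN-OPEN content of leaf S.4 is exactly (γ3) (row NE3's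
currency) — (γ1) is located one-run, (γ2) is row NE4, (γ4) is bookkeeping, `W` is the β-road.

WHAT IS PROVED ([folklore]).
§1 `abs_sum_mul_le_of_nonneg`, `abs_sum_mul_le_abs`, **`block_split`** — the grouped identity and the bound
   `|γ_B − γ_A| ≤ (ι + d)·Aact + W·(e + δ)`.
§2 `weightDev_of_discrete031` — `1/g_{K,K}² ≤ w ≤ 1/g_{K,k}²` and `Step.Discrete031 b β′ K g g_{K,·}` give
   `|w − 1/g_{K,K}²| ≤ β′(K − k)`; `weightDev_of_discrete031_le` — hence `≤ β′·K`.
§3 **`couplingMismatch_radius`** — the END's binder (γ) PRODUCED: indexed by cutoff `K`, source `t`, good term `τ` and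
   admissible datum `v`, from the representations of `γ^A`, `γ^B` as the weighted sums and (γ1)–(γ4) with per-unit-
   volume majorants `Aact ≤ vol·cA_K`, `e ≤ vol·eK_K`, `δ ≤ vol·dK_K`:
   `|γ^B − γ^A| ≤ vol·rγ_K`, `rγ_K = (ι_K + d_K)·cA_K + W_K·(eK_K + dK_K)` — EXACTLY the shape of `hγ` in
   `TermwiseLocal.goodClause_summable_UN_levels_of_thm1At(_coarse)`.
§4 **`summable_couplingRadius`** — `Σ_K rγ_K < ∞` when `ι, d, eK, dK ≤ C(K+1)^p θ^K`
   (`0 ≤ θ < 1`) and `cA, W ≤ C(K+1)^p` (polynomial): the `hrγ` binder of the END.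
§5 `toy_block_split` — (γ1)–(γ4) jointly inhabited with `γ^B ≠ γ^A` (two blocks, two fine plaquettes each).
§6 (v1.1) `block_split_weighted` — the same split for a PARTITION OF UNITY `ω y x` in place of the block map (Bałaban's
   averaging families (42)∕(46) of B7 overlap: a fine plaquette feeds the coarse plaquettes of the four blocks of `Δ(p′)`);
   `block_split_of_weighted` — indicator weights recover §1's fibres.

NOT DELIVERED: any producer of (γ1)–(γ4) for Bałaban's objects; the identification of `w`, `ρ`, `blk` with (2.23)–
(2.24) beyond the located sentences (NODE O of the skeleton).  NOT NE7 (spine 0/9 unchanged), NOT summit progress.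
-/

noncomputable section

open Finset
open scoped BigOperators

namespace Summit.QuantumFields.BalabanUV.T4Continuum.TermwiseCouplingMismatch

open Literature.MathematicalPhysics.QuantumFieldTheory.Balaban1983to89

/-! ## §1 The block-grouped split of the coupling-mismatch difference -/

section Split

/-- `|Σ a·ρ| ≤ c·Σ ρ` for `|a| ≤ c` and `ρ ≥ 0` termwise. [folklore] -/
theorem abs_sum_mul_le_of_nonneg {X : Type*} (s : Finset X) {a ρ : X → ℝ} {c : ℝ}
    (ha : ∀ x ∈ s, |a x| ≤ c) (hρ : ∀ x ∈ s, 0 ≤ ρ x) :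
    |∑ x ∈ s, a x * ρ x| ≤ c * ∑ x ∈ s, ρ x := by
  calc |∑ x ∈ s, a x * ρ x| ≤ ∑ x ∈ s, |a x * ρ x| := abs_sum_le_sum_abs _ _
    _ ≤ ∑ x ∈ s, c * ρ x := sum_le_sum fun x hx => by
        rw [abs_mul, abs_of_nonneg (hρ x hx)]
        exact mul_le_mul_of_nonneg_right (ha x hx) (hρ x hx)
    _ = c * ∑ x ∈ s, ρ x := (mul_sum _ _ _).symm

/-- `|Σ a·b| ≤ c·Σ |b|` for `|a| ≤ c` termwise. [folklore] -/
theorem abs_sum_mul_le_abs {Y : Type*} (s : Finset Y) {a b : Y → ℝ} {c : ℝ} (ha : ∀ y ∈ s, |a y| ≤ c) :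
    |∑ y ∈ s, a y * b y| ≤ c * ∑ y ∈ s, |b y| := by
  calc |∑ y ∈ s, a y * b y| ≤ ∑ y ∈ s, |a y * b y| := abs_sum_le_sum_abs _ _
    _ ≤ ∑ y ∈ s, c * |b y| := sum_le_sum fun y hy => by
        rw [abs_mul]
        exact mul_le_mul_of_nonneg_right (ha y hy) (abs_nonneg _)
    _ = c * ∑ y ∈ s, |b y| := (mul_sum _ _ _).symm

/-- **THE BLOCK-GROUPED SPLIT.**  Fine plaquettes `PX` with a block map `blk` into coarse plaquettes `PY`; run B's
remainder `Σ_{x∈PX} (w_B x − w₀)·ρ_B x`, run A's `Σ_{y∈PY} (w_A y − w₀)·ρ_A y`.  With (γ1) `|w_B x − w̄(blk x)| ≤ ι`,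
run B's densities `ρ_B ≥ 0` of total `≤ Aact`, (γ2) `|w̄ y − w_A y| ≤ d`, the deviation `|w_A y − w₀| ≤ W`, (γ3)
`Σ_y |Σ_{blk x = y} ρ_B x − Σ_{blk x = y} ρ_L x| ≤ e` and (γ4) `Σ_y |Σ_{blk x = y} ρ_L x − ρ_A y| ≤ δ`:
`|γ_B − γ_A| ≤ (ι + d)·Aact + W·(e + δ)`.  Finite-sum algebra (`Finset.sum_fiberwise_of_maps_to`). [folklore] -/
theorem block_split {X Y : Type*} [DecidableEq Y] (PX : Finset X) (PY : Finset Y) (blk : X → Y)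
    (hblk : ∀ x ∈ PX, blk x ∈ PY) (wB ρB ρL : X → ℝ) (wbar wA ρA : Y → ℝ) (w₀ : ℝ) {ι d W Aact e δ : ℝ}
    (hι : ∀ x ∈ PX, |wB x - wbar (blk x)| ≤ ι) (hι0 : 0 ≤ ι) (hρB : ∀ x ∈ PX, 0 ≤ ρB x)
    (hAct : ∑ x ∈ PX, ρB x ≤ Aact) (hd : ∀ y ∈ PY, |wbar y - wA y| ≤ d) (hd0 : 0 ≤ d)
    (hW : ∀ y ∈ PY, |wA y - w₀| ≤ W) (hW0 : 0 ≤ W)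
    (he : ∑ y ∈ PY, |(∑ x ∈ PX with blk x = y, ρB x) - ∑ x ∈ PX with blk x = y, ρL x| ≤ e)
    (hδ : ∑ y ∈ PY, |(∑ x ∈ PX with blk x = y, ρL x) - ρA y| ≤ δ) :
    |(∑ x ∈ PX, (wB x - w₀) * ρB x) - ∑ y ∈ PY, (wA y - w₀) * ρA y| ≤ (ι + d) * Aact + W * (e + δ) := by
  have hfib : ∀ f : X → ℝ, ∑ y ∈ PY, ∑ x ∈ PX with blk x = y, f x = ∑ x ∈ PX, f x :=
    fun f => sum_fiberwise_of_maps_to hblk f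
  -- the four pieces
  set T1 : ℝ := ∑ x ∈ PX, (wB x - wbar (blk x)) * ρB x with hT1
  set T2 : ℝ := ∑ y ∈ PY, (wbar y - wA y) * ∑ x ∈ PX with blk x = y, ρB x with hT2
  set T3 : ℝ := ∑ y ∈ PY, (wA y - w₀) * ((∑ x ∈ PX with blk x = y, ρB x) - ∑ x ∈ PX with blk x = y, ρL x)
    with hT3
  set T4 : ℝ := ∑ y ∈ PY, (wA y - w₀) * ((∑ x ∈ PX with blk x = y, ρL x) - ρA y) with hT4
  -- regrouping run B's sum by blocks
  have eB : ∑ x ∈ PX, (wB x - w₀) * ρB x = T1 + ∑ y ∈ PY, (wbar y - w₀) * ∑ x ∈ PX with blk x = y, ρB x := by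
    have h1 : ∑ x ∈ PX, (wB x - w₀) * ρB x
        = (∑ x ∈ PX, (wB x - wbar (blk x)) * ρB x) + ∑ x ∈ PX, (wbar (blk x) - w₀) * ρB x := by
      rw [← sum_add_distrib]
      exact sum_congr rfl fun x _ => by ring
    rw [h1, hT1]
    congr 1
    rw [← hfib (fun x => (wbar (blk x) - w₀) * ρB x)]
    refine sum_congr rfl fun y _ => ?_
    rw [mul_sum]
    exact sum_congr rfl fun x hx => by rw [(mem_filter.1 hx).2]
  have eAll : (∑ x ∈ PX, (wB x - w₀) * ρB x) - ∑ y ∈ PY, (wA y - w₀) * ρA y = T1 + (T2 + (T3 + T4)) := by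
    rw [eB, hT2, hT3, hT4, add_sub_assoc]
    congr 1
    rw [← sum_add_distrib, ← sum_add_distrib, ← sum_sub_distrib]
    exact sum_congr rfl fun y _ => by ring
  -- bounds
  have b1 : |T1| ≤ ι * Aact :=
    (abs_sum_mul_le_of_nonneg PX (fun x hx => hι x hx) hρB).trans (mul_le_mul_of_nonneg_left hAct hι0)
  have hSB0 : ∀ y ∈ PY, 0 ≤ ∑ x ∈ PX with blk x = y, ρB x :=
    fun y _ => sum_nonneg fun x hx => hρB x (mem_filter.1 hx).1
  have b2 : |T2| ≤ d * Aact := by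
    refine (abs_sum_mul_le_of_nonneg PY (fun y hy => hd y hy) hSB0).trans ?_
    rw [hfib ρB]
    exact mul_le_mul_of_nonneg_left hAct hd0
  have b3 : |T3| ≤ W * e :=
    (abs_sum_mul_le_abs PY (fun y hy => hW y hy)).trans (mul_le_mul_of_nonneg_left he hW0)
  have b4 : |T4| ≤ W * δ :=
    (abs_sum_mul_le_abs PY (fun y hy => hW y hy)).trans (mul_le_mul_of_nonneg_left hδ hW0)
  rw [eAll]
  calc |T1 + (T2 + (T3 + T4))| ≤ |T1| + (|T2| + (|T3| + |T4|)) :=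
        (abs_add_le _ _).trans (add_le_add le_rfl ((abs_add_le _ _).trans (add_le_add le_rfl (abs_add_le _ _))))
    _ ≤ ι * Aact + (d * Aact + (W * e + W * δ)) := add_le_add b1 (add_le_add b2 (add_le_add b3 b4))
    _ = (ι + d) * Aact + W * (e + δ) := by ring

end Split

/-! ## §2 The coupling deviation from the flow window (0.31) — the β-road input, by name -/

section Flow

/-- A coupling value `w` between the final running value `1/g_{K,K}²` and the value `1/g_{K,k}²` frozen at level
`k ≤ K` deviates from the final one by at most `β′(K − k)`: the UPPER half of the typed flow window
`Step.Discrete031 b β′ K g g_{K,·}` ((0.31) of [Balaban1987RG1], the cell's BetaPertH road — a HYPOTHESIS here; the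
lower half is used only at `k = K`, where its `b`-term vanishes). [folklore] -/
theorem weightDev_of_discrete031 {b β' gf : ℝ} {K : ℕ} {gs : ℕ → ℝ} (h : Step.Discrete031 b β' K gf gs)
    {k : ℕ} (hk : k ≤ K) {w : ℝ} (hlo : 1 / gs K ^ 2 ≤ w) (hhi : w ≤ 1 / gs k ^ 2) :
    |w - 1 / gs K ^ 2| ≤ β' * ((K : ℝ) - k) := by
  have hK := (h K le_rfl).1
  have hkk := (h k hk).2
  have h0 : b * ((K : ℝ) - K) = 0 := by ring
  rw [abs_of_nonneg (by linarith)]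
  linarith

/-- Hence `≤ β′·K` (`0 ≤ β′`). [folklore] -/
theorem weightDev_of_discrete031_le {b β' gf : ℝ} {K : ℕ} {gs : ℕ → ℝ} (h : Step.Discrete031 b β' K gf gs)
    (hβ' : 0 ≤ β') {k : ℕ} (hk : k ≤ K) {w : ℝ} (hlo : 1 / gs K ^ 2 ≤ w) (hhi : w ≤ 1 / gs k ^ 2) :
    |w - 1 / gs K ^ 2| ≤ β' * K := by
  refine (weightDev_of_discrete031 h hk hlo hhi).trans (mul_le_mul_of_nonneg_left ?_ hβ')
  have : (0 : ℝ) ≤ k := Nat.cast_nonneg k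
  linarith

end Flow

/-! ## §3 The END's binder (γ) PRODUCED from (γ1)–(γ4), indexed by cutoff, source, good term and datum -/

section Indexed

variable {X Y : Type*} [DecidableEq Y] {ι' : Type} {σ : Type*} [DecidableEq σ] {l₀ vol w₀ : ℝ}
  {T : ℕ → Finset σ} {Bad : ℕ → ℝ → Finset σ} {Adm : Set ι'}

/-- **(γ) PRODUCED.**  For every cutoff `K`, source `|t| ≤ l₀`, good term `τ ∈ T K ∖ Bad K t` and admissible datum
`v`: the two runs' coupling-mismatch remainders are the weighted sums over the term's fine ∕ coarse plaquette sets
`PX`, `PY` (block map `blk`), and (γ1) `ι_K`, run B's action `≤ vol·cA_K`, (γ2) `d_K`, the deviation `W_K`, (γ3)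
`≤ vol·eK_K`, (γ4) `≤ vol·dK_K` hold — THEN the END's binder `hγ` holds with
`rγ_K = (ι_K + d_K)·cA_K + W_K·(eK_K + dK_K)`.  Every input is a hypothesis; nothing printed is asserted. [folklore] -/
theorem couplingMismatch_radius
    (PX : ℕ → ℝ → σ → ι' → Finset X) (PY : ℕ → ℝ → σ → ι' → Finset Y) (blk : ℕ → ℝ → σ → ι' → X → Y)
    (wB ρB ρL : ℕ → ℝ → σ → ι' → X → ℝ) (wbar wA ρA : ℕ → ℝ → σ → ι' → Y → ℝ)
    {γA γB : ℕ → ℝ → σ → ι' → ℝ} {ιK d W cA eK dK : ℕ → ℝ}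
    (hblk : ∀ K t, |t| ≤ l₀ → ∀ τ ∈ T K \ Bad K t, ∀ v ∈ Adm, ∀ x ∈ PX K t τ v, blk K t τ v x ∈ PY K t τ v)
    (hγB : ∀ K t, |t| ≤ l₀ → ∀ τ ∈ T K \ Bad K t, ∀ v ∈ Adm,
      γB K t τ v = ∑ x ∈ PX K t τ v, (wB K t τ v x - w₀) * ρB K t τ v x)
    (hγA : ∀ K t, |t| ≤ l₀ → ∀ τ ∈ T K \ Bad K t, ∀ v ∈ Adm,
      γA K t τ v = ∑ y ∈ PY K t τ v, (wA K t τ v y - w₀) * ρA K t τ v y)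
    -- (γ1) intra-block variation of run B's coupling; run B's one-run action on the support
    (hι : ∀ K t, |t| ≤ l₀ → ∀ τ ∈ T K \ Bad K t, ∀ v ∈ Adm, ∀ x ∈ PX K t τ v,
      |wB K t τ v x - wbar K t τ v (blk K t τ v x)| ≤ ιK K) (hι0 : ∀ K, 0 ≤ ιK K)
    (hρB : ∀ K t, |t| ≤ l₀ → ∀ τ ∈ T K \ Bad K t, ∀ v ∈ Adm, ∀ x ∈ PX K t τ v, 0 ≤ ρB K t τ v x)
    (hAct : ∀ K t, |t| ≤ l₀ → ∀ τ ∈ T K \ Bad K t, ∀ v ∈ Adm, ∑ x ∈ PX K t τ v, ρB K t τ v x ≤ vol * cA K)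
    -- (γ2) block coupling discrepancy (node U2 / row NE4) and the deviation of run A's coupling from `w₀` (§2)
    (hd : ∀ K t, |t| ≤ l₀ → ∀ τ ∈ T K \ Bad K t, ∀ v ∈ Adm, ∀ y ∈ PY K t τ v,
      |wbar K t τ v y - wA K t τ v y| ≤ d K) (hd0 : ∀ K, 0 ≤ d K)
    (hW : ∀ K t, |t| ≤ l₀ → ∀ τ ∈ T K \ Bad K t, ∀ v ∈ Adm, ∀ y ∈ PY K t τ v, |wA K t τ v y - w₀| ≤ W K)
    (hW0 : ∀ K, 0 ≤ W K)
    -- (γ3) two-run fine-action closeness per block (row NE3's currency); (γ4) one-run per-block classical deviation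
    (he : ∀ K t, |t| ≤ l₀ → ∀ τ ∈ T K \ Bad K t, ∀ v ∈ Adm,
      ∑ y ∈ PY K t τ v, |(∑ x ∈ PX K t τ v with blk K t τ v x = y, ρB K t τ v x)
        - ∑ x ∈ PX K t τ v with blk K t τ v x = y, ρL K t τ v x| ≤ vol * eK K)
    (hδ : ∀ K t, |t| ≤ l₀ → ∀ τ ∈ T K \ Bad K t, ∀ v ∈ Adm,
      ∑ y ∈ PY K t τ v, |(∑ x ∈ PX K t τ v with blk K t τ v x = y, ρL K t τ v x) - ρA K t τ v y| ≤ vol * dK K) :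
    ∀ K t, |t| ≤ l₀ → ∀ τ ∈ T K \ Bad K t, ∀ v ∈ Adm,
      |γB K t τ v - γA K t τ v| ≤ vol * ((ιK K + d K) * cA K + W K * (eK K + dK K)) := by
  intro K t ht τ hτ v hv
  rw [hγB K t ht τ hτ v hv, hγA K t ht τ hτ v hv]
  have h := block_split (PX K t τ v) (PY K t τ v) (blk K t τ v) (hblk K t ht τ hτ v hv) (wB K t τ v)
    (ρB K t τ v) (ρL K t τ v) (wbar K t τ v) (wA K t τ v) (ρA K t τ v) w₀ (hι K t ht τ hτ v hv) (hι0 K)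
    (hρB K t ht τ hτ v hv) (hAct K t ht τ hτ v hv) (hd K t ht τ hτ v hv) (hd0 K) (hW K t ht τ hτ v hv) (hW0 K)
    (he K t ht τ hτ v hv) (hδ K t ht τ hτ v hv)
  refine h.trans (le_of_eq ?_)
  ring

end Indexed

/-! ## §4 Summability of the produced radius from polynomial × geometric majorants -/

section Summable

/-- **`Σ_K rγ_K < ∞`** for the radius of `couplingMismatch_radius` when the four small inputs are
`≤ C·(K+1)^p·θ^K` (`0 ≤ θ < 1`: (γ1) from the window depth, (γ2) node U2's rate, (γ3) row NE3's rate, (γ4) the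
classical deviation) and the two large ones are polynomial, `cA_K, W_K ≤ C·(K+1)^p` (one-run action under the I-3
window; `W_K ≤ β′K` by §2): then `rγ_K ≤ 4C²·(K+1)^{2p}·θ^K`, summable by the tree's `T4CauchySum.summable_succ_pow_mul_geometric` BY NAME. [folklore] -/
theorem summable_couplingRadius {ιK d W cA eK dK : ℕ → ℝ} {C θ : ℝ} {p : ℕ} (hC : 0 ≤ C) (hθ0 : 0 ≤ θ)
    (hθ1 : θ < 1) (hι0 : ∀ K, 0 ≤ ιK K) (hι : ∀ K, ιK K ≤ C * ((K : ℝ) + 1) ^ p * θ ^ K) (hd0 : ∀ K, 0 ≤ d K)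
    (hd : ∀ K, d K ≤ C * ((K : ℝ) + 1) ^ p * θ ^ K) (hW0 : ∀ K, 0 ≤ W K) (hW : ∀ K, W K ≤ C * ((K : ℝ) + 1) ^ p)
    (hcA0 : ∀ K, 0 ≤ cA K) (hcA : ∀ K, cA K ≤ C * ((K : ℝ) + 1) ^ p) (heK0 : ∀ K, 0 ≤ eK K)
    (heK : ∀ K, eK K ≤ C * ((K : ℝ) + 1) ^ p * θ ^ K) (hdK0 : ∀ K, 0 ≤ dK K)
    (hdK : ∀ K, dK K ≤ C * ((K : ℝ) + 1) ^ p * θ ^ K) :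
    Summable (fun K : ℕ => (ιK K + d K) * cA K + W K * (eK K + dK K)) := by
  have hs := (T4CauchySum.summable_succ_pow_mul_geometric hθ0 hθ1 (p + p)).mul_left (4 * C ^ 2)
  refine Summable.of_nonneg_of_le (fun K => ?_) (fun K => ?_) hs
  · exact add_nonneg (mul_nonneg (add_nonneg (hι0 K) (hd0 K)) (hcA0 K))
      (mul_nonneg (hW0 K) (add_nonneg (heK0 K) (hdK0 K)))
  · have hP : 0 ≤ ((K : ℝ) + 1) ^ p := by positivity
    have hθK : 0 ≤ θ ^ K := pow_nonneg hθ0 K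
    have hsmall : 0 ≤ C * ((K : ℝ) + 1) ^ p * θ ^ K := by positivity
    have hbig : 0 ≤ C * ((K : ℝ) + 1) ^ p := by positivity
    have e1 : (ιK K + d K) * cA K ≤ (2 * (C * ((K : ℝ) + 1) ^ p * θ ^ K)) * (C * ((K : ℝ) + 1) ^ p) :=
      mul_le_mul (by linarith [hι K, hd K]) (hcA K) (hcA0 K) (by positivity)
    have e2 : W K * (eK K + dK K) ≤ (C * ((K : ℝ) + 1) ^ p) * (2 * (C * ((K : ℝ) + 1) ^ p * θ ^ K)) :=
      mul_le_mul (hW K) (by linarith [heK K, hdK K]) (add_nonneg (heK0 K) (hdK0 K)) hbig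
    calc (ιK K + d K) * cA K + W K * (eK K + dK K)
        ≤ (2 * (C * ((K : ℝ) + 1) ^ p * θ ^ K)) * (C * ((K : ℝ) + 1) ^ p)
          + (C * ((K : ℝ) + 1) ^ p) * (2 * (C * ((K : ℝ) + 1) ^ p * θ ^ K)) := add_le_add e1 e2
      _ = 4 * C ^ 2 * (((K : ℝ) + 1) ^ (p + p) * θ ^ K) := by ring

end Summable

/-! ## §5 Non-vacuity: (γ1)–(γ4) jointly inhabited with `γ^B ≠ γ^A` -/

section Toy

/-- Two blocks `{0, 1}`, fine plaquettes `Fin 4` with `blk x = x / 2`; run B's coupling `w_B ≡ 2` on block 0 and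
`≡ 1` on block 1 (block-constant, `ι = 0`), run A's `w_A = (2, 1)`, `w₀ = 1`, densities `ρ_B ≡ 1`, lift `ρ_L ≡ 1`,
coarse `ρ_A = (3, 2)`: then `γ_B = 2`, `γ_A = 3`, and `block_split`'s bound is `(0 + 0)·4 + 1·(0 + 1) = 1 = |γ_B − γ_A|`
— the bound is ATTAINED and the two runs differ. [folklore] -/
theorem toy_block_split :
    |(∑ x ∈ (Finset.univ : Finset (Fin 4)), ((if x.val < 2 then (2 : ℝ) else 1) - 1) * 1)
        - ∑ y ∈ (Finset.univ : Finset (Fin 2)), ((if y.val = 0 then (2 : ℝ) else 1) - 1) * (if y.val = 0 then 3 else 2)|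
      = 1 ∧ ((0 : ℝ) + 0) * 4 + 1 * (0 + 1) = 1 := by
  constructor
  · simp [Fin.sum_univ_four, Fin.sum_univ_two]
    norm_num
  · norm_num

end Toy


/-! ## §6 (v1.1) The WEIGHTED grouping — for Bałaban's overlapping averaging families ((42)∕(46) of B7: a fine
plaquette contributes to the coarse plaquettes of the four blocks of `Δ(p′)`), the partition `blk` of §1 is replaced
by a partition of unity `ω y x ≥ 0`, `Σ_y ω y x = 1`; same bound, same four inputs with the block sums
`S(y) = Σ_x ω y x·ρ(x)` -/

section Weighted

/-- **THE WEIGHTED SPLIT.**  As `block_split`, with the fibres of `blk` replaced by weights `ω y x ≥ 0` summing to `1`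
over `y ∈ PY` for every fine `x ∈ PX` (a partition of unity — e.g. `L²·w y x` for the averaging weights of
`TermwiseLevels.averagingError_le_levels`, whose columns sum to `L⁻²`), the intra-family variation (γ1) asked where
`ω y x > 0`, and (γ3)(γ4) about the weighted block sums `Σ_x ω y x·ρ_B x`, `Σ_x ω y x·ρ_L x`:
`|γ_B − γ_A| ≤ (ι + d)·Aact + W·(e + δ)`. [folklore] -/
theorem block_split_weighted {X Y : Type*} (PX : Finset X) (PY : Finset Y) (ω : Y → X → ℝ)
    (hω : ∀ y ∈ PY, ∀ x ∈ PX, 0 ≤ ω y x) (hω1 : ∀ x ∈ PX, ∑ y ∈ PY, ω y x = 1)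
    (wB ρB ρL : X → ℝ) (wbar wA ρA : Y → ℝ) (w₀ : ℝ) {ι d W Aact e δ : ℝ}
    (hι : ∀ y ∈ PY, ∀ x ∈ PX, 0 < ω y x → |wB x - wbar y| ≤ ι) (hι0 : 0 ≤ ι) (hρB : ∀ x ∈ PX, 0 ≤ ρB x)
    (hAct : ∑ x ∈ PX, ρB x ≤ Aact) (hd : ∀ y ∈ PY, |wbar y - wA y| ≤ d) (hd0 : 0 ≤ d)
    (hW : ∀ y ∈ PY, |wA y - w₀| ≤ W) (hW0 : 0 ≤ W)
    (he : ∑ y ∈ PY, |(∑ x ∈ PX, ω y x * ρB x) - ∑ x ∈ PX, ω y x * ρL x| ≤ e)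
    (hδ : ∑ y ∈ PY, |(∑ x ∈ PX, ω y x * ρL x) - ρA y| ≤ δ) :
    |(∑ x ∈ PX, (wB x - w₀) * ρB x) - ∑ y ∈ PY, (wA y - w₀) * ρA y| ≤ (ι + d) * Aact + W * (e + δ) := by
  -- Σ_x f x = Σ_y Σ_x ω y x * f x (partition of unity)
  have hpu : ∀ f : X → ℝ, ∑ x ∈ PX, f x = ∑ y ∈ PY, ∑ x ∈ PX, ω y x * f x := fun f => by
    rw [Finset.sum_comm]
    refine sum_congr rfl fun x hx => ?_
    rw [← sum_mul, hω1 x hx, one_mul]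
  set T1 : ℝ := ∑ y ∈ PY, ∑ x ∈ PX, ω y x * ((wB x - wbar y) * ρB x) with hT1
  set T2 : ℝ := ∑ y ∈ PY, (wbar y - wA y) * ∑ x ∈ PX, ω y x * ρB x with hT2
  set T3 : ℝ := ∑ y ∈ PY, (wA y - w₀) * ((∑ x ∈ PX, ω y x * ρB x) - ∑ x ∈ PX, ω y x * ρL x) with hT3
  set T4 : ℝ := ∑ y ∈ PY, (wA y - w₀) * ((∑ x ∈ PX, ω y x * ρL x) - ρA y) with hT4
  have eB : ∑ x ∈ PX, (wB x - w₀) * ρB x = T1 + ∑ y ∈ PY, (wbar y - w₀) * ∑ x ∈ PX, ω y x * ρB x := by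
    rw [hpu (fun x => (wB x - w₀) * ρB x), hT1, ← sum_add_distrib]
    refine sum_congr rfl fun y _ => ?_
    rw [mul_sum, ← sum_add_distrib]
    exact sum_congr rfl fun x _ => by ring
  have eAll : (∑ x ∈ PX, (wB x - w₀) * ρB x) - ∑ y ∈ PY, (wA y - w₀) * ρA y = T1 + (T2 + (T3 + T4)) := by
    rw [eB, hT2, hT3, hT4, add_sub_assoc]
    congr 1
    rw [← sum_add_distrib, ← sum_add_distrib, ← sum_sub_distrib]
    exact sum_congr rfl fun y _ => by ring
  -- bounds
  have b1 : |T1| ≤ ι * Aact := by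
    have key : ∀ y ∈ PY, |∑ x ∈ PX, ω y x * ((wB x - wbar y) * ρB x)| ≤ ι * ∑ x ∈ PX, ω y x * ρB x := by
      intro y hy
      calc |∑ x ∈ PX, ω y x * ((wB x - wbar y) * ρB x)| ≤ ∑ x ∈ PX, |ω y x * ((wB x - wbar y) * ρB x)| :=
            abs_sum_le_sum_abs _ _
        _ ≤ ∑ x ∈ PX, ι * (ω y x * ρB x) := sum_le_sum fun x hx => by
            have hωx := hω y hy x hx
            have hρx := hρB x hx
            rcases hωx.eq_or_lt with h0 | hpos
            · rw [← h0]; simp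
            · rw [abs_mul, abs_of_nonneg hωx, abs_mul, abs_of_nonneg hρx]
              have := hι y hy x hx hpos
              calc ω y x * (|wB x - wbar y| * ρB x) ≤ ω y x * (ι * ρB x) :=
                    mul_le_mul_of_nonneg_left (mul_le_mul_of_nonneg_right this hρx) hωx
                _ = ι * (ω y x * ρB x) := by ring
        _ = ι * ∑ x ∈ PX, ω y x * ρB x := (mul_sum _ _ _).symm
    calc |T1| ≤ ∑ y ∈ PY, |∑ x ∈ PX, ω y x * ((wB x - wbar y) * ρB x)| := abs_sum_le_sum_abs _ _
      _ ≤ ∑ y ∈ PY, ι * ∑ x ∈ PX, ω y x * ρB x := sum_le_sum key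
      _ = ι * ∑ x ∈ PX, ρB x := by rw [← mul_sum, ← hpu ρB]
      _ ≤ ι * Aact := mul_le_mul_of_nonneg_left hAct hι0
  have hSB0 : ∀ y ∈ PY, 0 ≤ ∑ x ∈ PX, ω y x * ρB x :=
    fun y hy => sum_nonneg fun x hx => mul_nonneg (hω y hy x hx) (hρB x hx)
  have b2 : |T2| ≤ d * Aact := by
    refine (abs_sum_mul_le_of_nonneg PY (fun y hy => hd y hy) hSB0).trans ?_
    rw [← hpu ρB]
    exact mul_le_mul_of_nonneg_left hAct hd0
  have b3 : |T3| ≤ W * e :=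
    (abs_sum_mul_le_abs PY (fun y hy => hW y hy)).trans (mul_le_mul_of_nonneg_left he hW0)
  have b4 : |T4| ≤ W * δ :=
    (abs_sum_mul_le_abs PY (fun y hy => hW y hy)).trans (mul_le_mul_of_nonneg_left hδ hW0)
  rw [eAll]
  calc |T1 + (T2 + (T3 + T4))| ≤ |T1| + (|T2| + (|T3| + |T4|)) :=
        (abs_add_le _ _).trans (add_le_add le_rfl ((abs_add_le _ _).trans (add_le_add le_rfl (abs_add_le _ _))))
    _ ≤ ι * Aact + (d * Aact + (W * e + W * δ)) := add_le_add b1 (add_le_add b2 (add_le_add b3 b4))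
    _ = (ι + d) * Aact + W * (e + δ) := by ring

/-- The partition split `block_split` IS the weighted split with the indicator weights `ω y x = [blk x = y]`.
[folklore] -/
theorem block_split_of_weighted {X Y : Type*} [DecidableEq Y] (PX : Finset X) (blk : X → Y) (f : X → ℝ)
    (y : Y) :
    ∑ x ∈ PX, (if blk x = y then (1 : ℝ) else 0) * f x = ∑ x ∈ PX with blk x = y, f x := by
  rw [sum_filter]
  exact sum_congr rfl fun x _ => by split_ifs <;> simp

end Weighted

end Summit.QuantumFields.BalabanUV.T4Continuum.TermwiseCouplingMismatch
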